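import Summits.HodgeConjecture.HodgeConjecture.Theorems.H413E2SWIdentityCloseSplit
import Literature.NumberTheory.Automorphic.AdelicPiSchwartzBruhatDensity
import HarnessLib

/-!
# H413 · E-2 · SW2 (iii) — I-CLOSE: transport of the weighted-marginal identity back to `X□(𝔸)` (step (T2b) of the outer assembly)

Cell `hodgecm-mathlib`, crux H413 (`stmt-HodgeConjecture-24833`), child line `Cruxes/H413/Lines/F0_E2SiegelWeilWeilRange.lean` ED. 8,
stub `stub_SW2iii_siegelWeil`, identity half; pen sheet `F0/P4/F0P2a-p08/SW2-ICLOSE-ASSEMBLY.v0` §2 steps (1) and (4)→(5) in the WEIGHTED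
form (F0P4-plan (g4) RULING «WEIGHTS» 2026-08-31T03:36:58Z).  KERNEL MATHEMATICS ONLY (no definition, no `sorry`); imports ★ (T2a)
`Theorems.H413E2SWIdentityCloseSplit` + ★ `Automorphic.AdelicPiSchwartzBruhatDensity`.  HC_CM is proved only modulo the 7 printed
citations until rung 0 closes; nothing here is about Hodge classes.

WHAT THIS FILE DOES.  (T1) (`Theorems/H413E2SWIdentityClose`, skeleton) consumes, for every `b ∈ F`, the proportionality of the
theta-side and Eisenstein-side fibre measures `μ̂_b`, `μ_b` on `X = X□(𝔸)` TESTED ON COMPACTLY SUPPORTED `Θ ∈ 𝒮_ℝ(X)`: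
`∫ Θ dμ̂_b = κ₀ ∫ Θ dμ_b`.  (T2a) proves, in the split-place frame `e : X ≃ (K^ι × K^ι) × Y`, the identity
`∫⁻_{A × Y} φ d(e_*μ̂_b) = κ₀ ∫⁻_{A × Y} φ d(e_*μ_b)` for every measurable `A ⊆ K^ι × K^ι` and every admissible WEIGHT `φ ≥ 0` on `Y`
whose dilated-box masses obey the (BOUND-b) estimate.  Here:
* §1 `integral_eq_mul_integral_of_forall_nonneg` — the SIGN REDUCTION on `X = 𝔸_F^ι`: an identity `∫ Θ dν₁ = κ ∫ Θ dν₂` known for all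
  NONNEGATIVE compactly supported `Θ ∈ 𝒮_ℝ` holds for all compactly supported `Θ ∈ 𝒮_ℝ` (`Θ = (Θ + C χ) − C χ` with the Schwartz–Bruhat
  cut-off `χ = 1` on `tsupport Θ` of ★ `exists_piSchwartzBruhatReal_cutoff`);
* §2 `integral_indicator_mul_comp_eq_toReal`, `integrable_indicator_mul_comp` — one SLICE `x ↦ 𝟙_A((e x).1) · φ((e x).2)` is integrable
  and its integral is the weighted rectangle mass `(∫⁻_{A × Y} φ d(e_*ν)).toReal`;
* §2 `integral_eq_smul_integral_of_slices` — THE TRANSPORT: for `Θ = Σ_{t ∈ T} 𝟙_{A_t}((e x).1) · φ_t((e x).2)` (the pure-tensor SLICES of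
  a nonnegative compactly supported Schwartz–Bruhat function at the place `v`: B-p18 (TENS-v) `exists_sum_indicator_mul_slice_real` composed
  with the split frame `β_v` of B-p04∕A-p01), with `A_t` compact measurable and `φ_t ≥ 0` bounded measurable compactly supported, and the
  dilate bound for each `φ_t`, (T2a) ★ `setLIntegral_prod_univ_eq_smul_of_dilate_bound` per slice gives `∫ Θ dν₁ = κ₀ ∫ Θ dν₂`.
The remaining glue to (T1)'s `hfib` — the frame `e` with its invariance∕carrier clauses and the slice decomposition — is the producers'
(A-p01 `Theorems/H413E2SWSplitPlaceFrame`, B-p18 TENS-v, F0P4-p08 COEFF-b).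

References: A. Weil, *Sur la formule de Siegel dans la théorie des groupes classiques*, Acta Math. 113 (1965), Chap. V n° 50 (39)–(40)
p. 74; Chap. VI n° 51–52 pp. 75–77 [Weil1965].  A. Weil, *Basic Number Theory* (1967), Ch. VII §2 [WeilBNT1967].
-/

set_option autoImplicit false
-- the cell's `Summit.HodgeConjecture.HodgeConjecture.…` namespace repeats the summit name by design (D-0017 layout)
set_option linter.dupNamespace false

noncomputable section

open MeasureTheory Filter Topology Set NumberField
open scoped NNReal ENNReal Matrix
open Literature.NumberTheory.Automorphic Literature.NumberTheory.Weil1965.SplitPlace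
open Literature.NumberTheory.GaloisRepresentations.IsNonarchimedeanLocalField
open Summit.HodgeConjecture.HodgeConjecture.Cruxes.H413.E2SWIdentityCloseCore
open Summit.HodgeConjecture.HodgeConjecture.Cruxes.H413.E2SWIdentityCloseSplit

namespace Summit.HodgeConjecture.HodgeConjecture.Cruxes.H413.E2SWIdentityCloseTransport

/-! ## §1 Sign reduction on `𝒮_ℝ(𝔸_F^ι)` -/

section Sign

variable (F : Type) [Field F] [NumberField F] (ι : Type) [Fintype ι]
  [MeasurableSpace (AdeleRing (𝓞 F) F)] [BorelSpace (AdeleRing (𝓞 F) F)]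

/-- **SIGN REDUCTION.**  Let `ν₁, ν₂` be measures on `𝔸_F^ι` finite on compacta and `κ ∈ ℝ`.  If `∫ Θ dν₁ = κ ∫ Θ dν₂` for every
NONNEGATIVE compactly supported `Θ ∈ 𝒮_ℝ(𝔸_F^ι)`, then the same holds for every compactly supported `Θ ∈ 𝒮_ℝ(𝔸_F^ι)`:
`Θ = (Θ + C χ) − C χ` with `C ≥ sup |Θ|` and `χ ∈ 𝒮_ℝ` the cut-off of ★ `exists_piSchwartzBruhatReal_cutoff` (`0 ≤ χ ≤ 1`, compact support,
`χ = 1` on `tsupport Θ`), both summands nonnegative. [cite: WeilBNT1967, Ch. VII §2] -/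
theorem integral_eq_mul_integral_of_forall_nonneg (ν₁ ν₂ : Measure (ι → AdeleRing (𝓞 F) F))
    [IsFiniteMeasureOnCompacts ν₁] [IsFiniteMeasureOnCompacts ν₂] (κ : ℝ)
    (h : ∀ Θ : piSchwartzBruhatReal F ι, 0 ≤ (Θ : (ι → AdeleRing (𝓞 F) F) → ℝ) →
      HasCompactSupport (Θ : (ι → AdeleRing (𝓞 F) F) → ℝ) →
      ∫ x, (Θ : (ι → AdeleRing (𝓞 F) F) → ℝ) x ∂ν₁ = κ * ∫ x, (Θ : (ι → AdeleRing (𝓞 F) F) → ℝ) x ∂ν₂)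
    (Θ : piSchwartzBruhatReal F ι) (hΘ : HasCompactSupport (Θ : (ι → AdeleRing (𝓞 F) F) → ℝ)) :
    ∫ x, (Θ : (ι → AdeleRing (𝓞 F) F) → ℝ) x ∂ν₁ = κ * ∫ x, (Θ : (ι → AdeleRing (𝓞 F) F) → ℝ) x ∂ν₂ := by
  haveI := secondCountableTopology_adeleRing (K := F)
  haveI : BorelSpace (ι → AdeleRing (𝓞 F) F) := Pi.borelSpace
  set θ : (ι → AdeleRing (𝓞 F) F) → ℝ := (Θ : (ι → AdeleRing (𝓞 F) F) → ℝ) with hθ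
  have hθc : Continuous θ := continuous_of_mem_piSchwartzBruhatReal Θ.2
  obtain ⟨C, hC⟩ := hθc.bounded_above_of_compact_support hΘ
  obtain ⟨χ, hχS, hχc, hχcs, -, hχ01, hχ1⟩ :=
    exists_piSchwartzBruhatReal_cutoff (K := F) (ι := ι) hΘ.isCompact isOpen_univ (Set.subset_univ _)
  -- the two nonnegative pieces `θ + C' • χ` and `C' • χ`
  set C' : ℝ := max C 0 with hC'
  have hC'0 : 0 ≤ C' := le_max_right _ _
  have h2mem : C' • χ ∈ piSchwartzBruhatReal F ι := (piSchwartzBruhatReal F ι).smul_mem C' hχS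
  have h1mem : θ + C' • χ ∈ piSchwartzBruhatReal F ι := (piSchwartzBruhatReal F ι).add_mem Θ.2 h2mem
  have h2nn : 0 ≤ C' • χ := fun x => by
    simp only [Pi.zero_apply, Pi.smul_apply, smul_eq_mul]
    exact mul_nonneg hC'0 (hχ01 x).1
  have h1nn : 0 ≤ θ + C' • χ := by
    intro x
    simp only [Pi.zero_apply, Pi.add_apply, Pi.smul_apply, smul_eq_mul]
    by_cases hx : x ∈ tsupport θ
    · rw [hχ1 x hx, mul_one]
      have h1 : ‖θ x‖ ≤ C := hC x
      rw [Real.norm_eq_abs] at h1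
      have h2 : -θ x ≤ C' := (neg_le_abs _).trans (h1.trans (le_max_left _ _))
      linarith
    · rw [image_eq_zero_of_notMem_tsupport hx, zero_add]
      exact mul_nonneg hC'0 (hχ01 x).1
  have h2cs : HasCompactSupport (C' • χ) := hχcs.smul_left
  have h1cs : HasCompactSupport (θ + C' • χ) := hΘ.add h2cs
  -- integrability of all pieces (continuous, compactly supported, measures finite on compacta)
  have h2c : Continuous (C' • χ) := hχc.const_smul C'
  have hi1 : ∀ (ν : Measure (ι → AdeleRing (𝓞 F) F)) [IsFiniteMeasureOnCompacts ν], Integrable θ ν :=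
    fun ν _ => hθc.integrable_of_hasCompactSupport hΘ
  have hi2 : ∀ (ν : Measure (ι → AdeleRing (𝓞 F) F)) [IsFiniteMeasureOnCompacts ν], Integrable (C' • χ) ν :=
    fun ν _ => h2c.integrable_of_hasCompactSupport h2cs
  -- apply `h` to the two pieces
  have e1 : ∫ x, (θ + C' • χ) x ∂ν₁ = κ * ∫ x, (θ + C' • χ) x ∂ν₂ := h ⟨θ + C' • χ, h1mem⟩ h1nn h1cs
  have e2 : ∫ x, (C' • χ) x ∂ν₁ = κ * ∫ x, (C' • χ) x ∂ν₂ := h ⟨C' • χ, h2mem⟩ h2nn h2cs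
  rw [integral_add' (hi1 ν₁) (hi2 ν₁), integral_add' (hi1 ν₂) (hi2 ν₂)] at e1
  -- `∫ θ = ∫ (θ + C'χ) − ∫ C'χ` on both sides
  have : ∫ x, θ x ∂ν₁ = (∫ x, θ x ∂ν₁ + ∫ x, (C' • χ) x ∂ν₁) - ∫ x, (C' • χ) x ∂ν₁ := by ring
  rw [this, e1, e2]
  ring

end Sign

/-! ## §2 Transport of the weighted identity along the split-place frame -/

section Transport

/-- a slice `z ↦ 𝟙_A(z.1) · φ(z.2)` is the indicator of the cylinder `A × Y` applied to `φ ∘ snd`. [folklore] -/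
theorem indicator_fst_mul_eq_indicator_prod {α β : Type*} (A : Set α) (φ : β → ℝ) (z : α × β) :
    A.indicator (fun _ => (1 : ℝ)) z.1 * φ z.2 = (A ×ˢ (univ : Set β)).indicator (fun z => φ z.2) z := by
  by_cases hz : z.1 ∈ A
  · rw [Set.indicator_of_mem hz, one_mul, Set.indicator_of_mem (Set.mk_mem_prod hz (Set.mem_univ _))]
  · rw [Set.indicator_of_notMem hz, zero_mul, Set.indicator_of_notMem (fun h => hz (Set.mem_prod.1 h).1)]

variable {X : Type*} [MeasurableSpace X]
variable {K : Type*} [Field K] [ValuativeRel K] [TopologicalSpace K] [IsNonarchimedeanLocalField K]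
variable {ι : Type*} [Fintype ι] [MeasurableSpace K] [BorelSpace K] (μK : Measure K) [μK.IsAddHaarMeasure]
variable {Y : Type*} [TopologicalSpace Y] [MeasurableSpace Y] [OpensMeasurableSpace Y]

omit [Field K] [ValuativeRel K] [IsNonarchimedeanLocalField K] [Fintype ι] [BorelSpace K] in
/-- **ONE SLICE IS INTEGRABLE** on `X` against `ν` when `A` is compact measurable, `φ` bounded measurable compactly supported, and `e_*ν` is
finite on compact rectangles. [folklore] -/
theorem integrable_indicator_mul_comp (ν : Measure X) (e : X ≃ᵐ (((ι → K) × (ι → K)) × Y))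
    (hfin : ∀ (L : Set ((ι → K) × (ι → K))) (T : Set Y), IsCompact L → IsCompact T → (ν.map e) (L ×ˢ T) < ⊤)
    {A : Set ((ι → K) × (ι → K))} (hAm : MeasurableSet A) (hAc : IsCompact A)
    {φ : Y → ℝ} (hφ : Measurable φ) (hφ0 : 0 ≤ φ) {C : ℝ} (hφC : ∀ y, φ y ≤ C) (hφs : HasCompactSupport φ) :
    Integrable (fun x => A.indicator (fun _ => (1 : ℝ)) (e x).1 * φ (e x).2) ν := by
  -- integrable on `X` iff the slice is integrable against `e_*ν`
  have hg : (fun x => A.indicator (fun _ => (1 : ℝ)) (e x).1 * φ (e x).2) =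
      (fun z : ((ι → K) × (ι → K)) × Y => (A ×ˢ tsupport φ).indicator (fun z => φ z.2) z) ∘ e := by
    funext x
    simp only [Function.comp_apply]
    rw [indicator_fst_mul_eq_indicator_prod]
    -- `φ` vanishes off `tsupport φ`, so the two indicators agree
    by_cases h1 : (e x).1 ∈ A
    · by_cases h2 : (e x).2 ∈ tsupport φ
      · rw [Set.indicator_of_mem (Set.mk_mem_prod h1 (Set.mem_univ _)), Set.indicator_of_mem (Set.mk_mem_prod h1 h2)]
      · rw [Set.indicator_of_mem (Set.mk_mem_prod h1 (Set.mem_univ _)),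
          Set.indicator_of_notMem (fun h => h2 (Set.mem_prod.1 h).2), image_eq_zero_of_notMem_tsupport h2]
    · rw [Set.indicator_of_notMem (fun h => h1 (Set.mem_prod.1 h).1), Set.indicator_of_notMem (fun h => h1 (Set.mem_prod.1 h).1)]
  rw [hg, ← integrable_map_equiv e, integrable_indicator_iff (hAm.prod (isClosed_tsupport φ).measurableSet)]
  refine Measure.integrableOn_of_bounded (hfin A _ hAc hφs.isCompact).ne (hφ.comp measurable_snd).aestronglyMeasurable
    (M := C) (ae_of_all _ fun z => ?_)
  rw [Real.norm_eq_abs, abs_of_nonneg (hφ0 z.2)]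
  exact hφC z.2

omit [Field K] [ValuativeRel K] [TopologicalSpace K] [IsNonarchimedeanLocalField K] [Fintype ι] [BorelSpace K] [TopologicalSpace Y]
  [OpensMeasurableSpace Y] in
/-- **THE INTEGRAL OF ONE SLICE IS THE WEIGHTED RECTANGLE MASS**: `∫_X 𝟙_A((e x).1) φ((e x).2) dν = (∫⁻_{A × Y} φ d(e_*ν)).toReal`
for `φ ≥ 0` measurable and `A` measurable. [folklore] -/
theorem integral_indicator_mul_comp_eq_toReal (ν : Measure X) (e : X ≃ᵐ (((ι → K) × (ι → K)) × Y))
    {A : Set ((ι → K) × (ι → K))} (hAm : MeasurableSet A) {φ : Y → ℝ} (hφ : Measurable φ) (hφ0 : 0 ≤ φ) :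
    ∫ x, A.indicator (fun _ => (1 : ℝ)) (e x).1 * φ (e x).2 ∂ν =
      (∫⁻ z in A ×ˢ (univ : Set Y), ENNReal.ofReal (φ z.2) ∂(ν.map e)).toReal := by
  have h1 : ∫ x, A.indicator (fun _ => (1 : ℝ)) (e x).1 * φ (e x).2 ∂ν =
      ∫ z, (A ×ˢ (univ : Set Y)).indicator (fun z => φ z.2) z ∂(ν.map e) := by
    rw [integral_map_equiv]
    exact integral_congr_ae (ae_of_all _ fun x => indicator_fst_mul_eq_indicator_prod A φ (e x))
  rw [h1, integral_indicator (hAm.prod MeasurableSet.univ),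
    integral_eq_lintegral_of_nonneg_ae (f := fun z : ((ι → K) × (ι → K)) × Y => φ z.2)
      (ae_of_all _ fun z => hφ0 z.2) (hφ.comp measurable_snd).aestronglyMeasurable]

include μK in
/-- **THE TRANSPORT (T2b).**  `|ι| ≥ 2`, `b : K`, `κ₀ : ℝ≥0`; `ν₁, ν₂` measures on `X` and a measurable equivalence
`e : X ≃ (K^ι × K^ι) × Y` (the split-place frame) such that `e_*ν₁`, `e_*ν₂` satisfy the hypotheses of (T2a) (finite on compact
rectangles, `GL_ι(K)`-invariant rectangle masses, carried by `S_b × Y`).  Let `Θ = Σ_{t ∈ T} 𝟙_{A_t}((e x).1) · φ_t((e x).2)` be a finite sum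
of SLICES with `A_t` compact measurable and weights `φ_t ≥ 0` bounded measurable compactly supported, each obeying the dilate bound
`|∫⁻_{D_n × Y} φ_t d(e_*ν₁) − κ₀ ∫⁻_{D_n × Y} φ_t d(e_*ν₂)| ≤ M_t ‖s_t n‖^{γ_t}`, `γ_t < |ι| − 1`, along some `‖s_t n‖ → ∞`.  Then
`∫ Θ dν₁ = κ₀ · ∫ Θ dν₂`. [cite: Weil1965, Chap. V n° 50, (39)–(40), p. 74] [cite: Weil1965, Chap. VI n° 52, Théorème 5, pp. 76–77] -/
theorem integral_eq_smul_integral_of_slices [Nonempty ι] [DecidableEq ι] [MeasurableSingletonClass K]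
    (hι : 2 ≤ Fintype.card ι) (b : K) (κ₀ : ℝ≥0)
    (ν₁ ν₂ : Measure X) (e : X ≃ᵐ (((ι → K) × (ι → K)) × Y))
    (hfin₁ : ∀ (L : Set ((ι → K) × (ι → K))) (T : Set Y), IsCompact L → IsCompact T → (ν₁.map e) (L ×ˢ T) < ⊤)
    (hfin₂ : ∀ (L : Set ((ι → K) × (ι → K))) (T : Set Y), IsCompact L → IsCompact T → (ν₂.map e) (L ×ˢ T) < ⊤)
    (hinv₁ : ∀ (g : GL ι K) (A : Set ((ι → K) × (ι → K))) (B : Set Y), MeasurableSet A → MeasurableSet B →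
      (ν₁.map e) (((fun z => (((g : Matrix ι ι K) *ᵥ z.1, ((g⁻¹ : GL ι K) : Matrix ι ι K)ᵀ *ᵥ z.2) :
        (ι → K) × (ι → K))) ⁻¹' A) ×ˢ B) = (ν₁.map e) (A ×ˢ B))
    (hinv₂ : ∀ (g : GL ι K) (A : Set ((ι → K) × (ι → K))) (B : Set Y), MeasurableSet A → MeasurableSet B →
      (ν₂.map e) (((fun z => (((g : Matrix ι ι K) *ᵥ z.1, ((g⁻¹ : GL ι K) : Matrix ι ι K)ᵀ *ᵥ z.2) :
        (ι → K) × (ι → K))) ⁻¹' A) ×ˢ B) = (ν₂.map e) (A ×ˢ B))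
    (hcar₁ : (ν₁.map e) ({z : (ι → K) × (ι → K) | z.1 ⬝ᵥ z.2 = b ∧ z.1 ≠ 0 ∧ z.2 ≠ 0}ᶜ ×ˢ (univ : Set Y)) = 0)
    (hcar₂ : (ν₂.map e) ({z : (ι → K) × (ι → K) | z.1 ⬝ᵥ z.2 = b ∧ z.1 ≠ 0 ∧ z.2 ≠ 0}ᶜ ×ˢ (univ : Set Y)) = 0)
    {τ : Type*} (T : Finset τ) (A : τ → Set ((ι → K) × (ι → K))) (φ : τ → Y → ℝ)
    (hAm : ∀ t ∈ T, MeasurableSet (A t)) (hAc : ∀ t ∈ T, IsCompact (A t))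
    (hφm : ∀ t ∈ T, Measurable (φ t)) (hφ0 : ∀ t ∈ T, 0 ≤ φ t) (C : τ → ℝ) (hφC : ∀ t ∈ T, ∀ y, φ t y ≤ C t)
    (hφs : ∀ t ∈ T, HasCompactSupport (φ t))
    (Θ : X → ℝ) (hΘ : ∀ x, Θ x = ∑ t ∈ T, (A t).indicator (fun _ => (1 : ℝ)) (e x).1 * φ t (e x).2)
    (hbd : ∀ t ∈ T, ∃ (s : ℕ → K) (M γ : ℝ), (∀ n, s n ≠ 0) ∧ Tendsto (fun n => (normAbs K (s n) : ℝ)) atTop atTop ∧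
      γ < (Fintype.card ι : ℝ) - 1 ∧
      ∀ n, |(∫⁻ z in {z : (ι → K) × (ι → K) | ((s n)⁻¹ • z.1, z.2) ∈ piPrimePowBall K ι 0 ×ˢ piPrimePowBall K ι 0} ×ˢ (univ : Set Y),
            ENNReal.ofReal (φ t z.2) ∂(ν₁.map e)).toReal -
          (κ₀ : ℝ) * (∫⁻ z in {z : (ι → K) × (ι → K) | ((s n)⁻¹ • z.1, z.2) ∈ piPrimePowBall K ι 0 ×ˢ piPrimePowBall K ι 0} ×ˢ (univ : Set Y),
            ENNReal.ofReal (φ t z.2) ∂(ν₂.map e)).toReal| ≤ M * (normAbs K (s n) : ℝ) ^ γ) :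
    ∫ x, Θ x ∂ν₁ = (κ₀ : ℝ) * ∫ x, Θ x ∂ν₂ := by
  -- slice by slice
  have hslice : ∀ t ∈ T,
      ∫ x, (A t).indicator (fun _ => (1 : ℝ)) (e x).1 * φ t (e x).2 ∂ν₁ =
        (κ₀ : ℝ) * ∫ x, (A t).indicator (fun _ => (1 : ℝ)) (e x).1 * φ t (e x).2 ∂ν₂ := by
    intro t ht
    obtain ⟨s, M, γ, hs0, hs, hγ, hbdt⟩ := hbd t ht
    rw [integral_indicator_mul_comp_eq_toReal ν₁ e (hAm t ht) (hφm t ht) (hφ0 t ht),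
      integral_indicator_mul_comp_eq_toReal ν₂ e (hAm t ht) (hφm t ht) (hφ0 t ht),
      setLIntegral_prod_univ_eq_smul_of_dilate_bound μK hι b κ₀ (ν₁.map e) (ν₂.map e) hfin₁ hfin₂ hinv₁ hinv₂ hcar₁ hcar₂
        (hφm t ht) (hφC t ht) (hφs t ht) hs0 hs hγ hbdt (hAm t ht),
      ENNReal.toReal_mul, ENNReal.coe_toReal]
  -- sum up
  have hΘ' : Θ = fun x => ∑ t ∈ T, (A t).indicator (fun _ => (1 : ℝ)) (e x).1 * φ t (e x).2 := funext hΘ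
  rw [hΘ', integral_finsetSum T (fun t ht => integrable_indicator_mul_comp ν₁ e hfin₁ (hAm t ht) (hAc t ht) (hφm t ht) (hφ0 t ht)
      (hφC t ht) (hφs t ht)),
    integral_finsetSum T (fun t ht => integrable_indicator_mul_comp ν₂ e hfin₂ (hAm t ht) (hAc t ht) (hφm t ht) (hφ0 t ht)
      (hφC t ht) (hφs t ht)), Finset.mul_sum]
  exact Finset.sum_congr rfl hslice

end Transport

end Summit.HodgeConjecture.HodgeConjecture.Cruxes.H413.E2SWIdentityCloseTransport

end
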